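import Literature.NumberTheory.Automorphic.ShimuraCurveCartanLevel
import Literature.NumberTheory.Automorphic.ShimuraCurveIdealsPrincipal
import Literature.NumberTheory.Automorphic.ShimuraCurveDataExistence
import Literature.NumberTheory.Automorphic.ShimuraCurveGroupDiscrete
import Literature.NumberTheory.Automorphic.BrandtModuleSplitLocal
import Literature.NumberTheory.Automorphic.QuaternionLocalSplit
import HarnessLib

/-!
# Hecke cosets of a Cartan-level Shimura curve vs. those of its Eichler hull:
# `Γ ∖ ι(O(ℓ)) ≃ Γ₀ ∖ ι(O₀(ℓ))` for `ℓ ∤ ∏_C q`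

Topic `NumberTheory/Automorphic`; theorems only (no definition, no named fact, no instance, no
`sorry`). Let `X : CartanLevelCurveData D M C` (`ShimuraCurveCartanLevel.lean`): an indefinite
quaternion algebra `B/ℚ` of discriminant `D` with a real splitting `ι`, an Eichler order `O₀` of
level `M` (the HULL) and the Cartan order `O ⊆ O₀` — equal to `O₀` away from the finite set `C` of
primes `q ∤ D M` and the non-split Cartan order `ℤ_{q²} + q O₀,q` at `q ∈ C`, pinned by the fields
`le`, `smul_mem`, `relIndex_eq`, `saturated`, `isDivisionRing_mod`; `Γ = ι(O¹)`, `X.heckeSet n = ι(O(n))`,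
`X.heckeSetoid n` = left `Γ`-cosets. Under it sits the Eichler datum
`X₀ = X.toShimuraCurveData fd₀ h : ShimuraCurveData D M` (same algebra, splitting and `O₀`; a
fundamental domain `fd₀` of `ι(O₀¹)` always exists, `exists_isHypFundamentalDomain_hull`), with
`Γ₀ = ι(O₀¹) ⊇ Γ` and `ι(O₀(n)) ⊇ ι(O(n))`.

MAIN THEOREM (`CartanLevelCurveData.nonempty_quotient_heckeSetoid_equiv_hull`,
`natCard_quotient_heckeSetoid_eq_hull`): for a prime `ℓ` dividing no `q ∈ C`, the map of coset spaces
`Γ ∖ ι(O(ℓ)) → Γ₀ ∖ ι(O₀(ℓ))` induced by the inclusion is a BIJECTION. Hence the degree of the Hecke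
correspondence `T_ℓ` on the Cartan-level curve equals the degree `ℓ + 1` on `X₀^D(M)` (Shimura 1971
Prop. 3.36: `deg Γ'αΓ' = deg ΓαΓ` for `Γ' ⊆ Γ` of level prime to `det α`; Kohen–Pacetti 2016 §1.3
at `D = 1`); the count itself is assembled in `ShimuraCurveCartanLevelHeckeDegree.lean`
(`cartanLevel_card_heckeCosets_eq_holds`) from this file and `ShimuraCurveHeckeDegree.lean`.

PROOF. Write `x ∈ q O₀` for `∃ y ∈ O₀, x = q • y`.
* INJECTIVITY (`mem_O_of_mul_mem`): if `u ∈ O₀`, `x ∈ O` with `x ∉ q O₀` for every `q ∈ C` (e.g.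
  `nrd x = ℓ`, as `nrd(q y) = q² nrd y`), and `u x ∈ O`, then `u ∈ O`: `isDivisionRing_mod` gives
  `z ∈ O`, `y ∈ O₀` with `x z - 1 = q y`, so `u - (u x) z = -q (u y)` and `saturated` applies. Hence a
  hull unit `γ₀ ∈ Γ₀` carrying one element of `ι(O(ℓ))` to another lies in `Γ`
  (`mem_Gamma_of_mul_mem_heckeSet`).
* SURJECTIVITY (`exists_normOne_mul_mem`): for `x₀ ∈ O₀` with `nrd x₀ = ℓ` there is `u ∈ O₀`,
  `nrd u = 1`, with `u x₀ ∈ O`. For each `q ∈ C` the index identity `[O₀ : O] = ∏ q²` forbids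
  `O ⊆ ℤ + q O₀` (that lattice has index `q³`), giving `η_q ∈ O ∖ (ℤ + q O₀)` (`exists_mem_O_not_mem`);
  the division-ring field then forces `disc(η_q) = t² - 4n ≢ 0 (mod q)` for odd `q` and `t, n` odd at
  `q = 2` (`t = trd η_q`, `n = nrd η_q`), whence some `c_q = a + b η_q ∈ ℤ[η_q] ⊆ O` has
  `nrd(c_q) · ℓ ≡ 1 (mod q)`, resp. `(mod 16)` (a binary form of non-zero discriminant represents every
  class mod `q`, Mathlib `FiniteField.exists_root_sum_quadratic`; at `2` a `decide`d table mod `8`).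
  Put `t_q = c_q · x̄₀ ∈ O₀`: `t_q x₀ = ℓ c_q ∈ O` and `nrd t_q = nrd(c_q) ℓ ≡ 1`. The lattice
  `Λ = {x ∈ O₀ : x ∈ ℤ t_q + q O₀ for all q ∈ C}` is full (`(∏ q) O₀ ⊆ Λ`) and has local points of norm
  `≡ 1 (mod 8p)` everywhere (`(∏_{q' ≠ q} q') m t_q` at `q ∈ C`, `1` elsewhere), so Eichler–Kneser strong
  approximation in the lattice form of the tree (`QuaternionAlgebra.exists_mem_mul_star_eq_one`,
  transported to an integral model `B ≃ ℍ[ℚ,a,b]` exactly as in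
  `ShimuraCurveData.exists_eq_units_smul_of_pos`) yields `u ∈ Λ` of norm `1`; then
  `u x₀ ∈ ℤ t_q x₀ + q O₀ x₀ ⊆ O + q O₀` for every `q`, so `u x₀ ∈ O` by `saturated`.
No residue MODEL `O₀ ↠ M₂(𝔽_q)` is used: everything is phrased with the structure fields of the datum.
(The Summits-side helper files `ClassRecordThreeEulerHalvesAtThreeCartanTransport{Hull,NormOneLift}`
of the BSD cell prove cognate statements — a fundamental domain for the hull, norm-one hull units with
prescribed residues at the ODD Cartan primes up to sign; they cannot be imported into `Literature/`,
and the present surjectivity needs the prime `2 ∈ C` as well, handled by the `mod 16` refinement.)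

Filed by the BSD cell `bsd-stepL` (seat `defn-ty1` g41). Nothing arithmetic is asserted; BSD is
proved for no curve.

## References

* G. Shimura, *Introduction to the arithmetic theory of automorphic functions* (1971), §3.3,
  Prop. 3.36. [cite: ShimuraIATAF1971, Prop. 3.36 and §3.3]
* M.-F. Vignéras, *Arithmétique des algèbres de quaternions*, LNM 800 (1980), Ch. III §4 Thm. 4.3
  (strong approximation), §5 Cor. 5.7; Ch. IV §1 Thm. 1.1. [cite: VignerasLNM800, Ch. III §4 Thm. 4.3 and §5 Cor. 5.7]
* D. Kohen, A. Pacetti, *Heegner points on Cartan non-split curves*, Canad. J. Math. 68 (2016),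
  §1.3. [cite: KohenPacetti2016, §1.3]
-/

noncomputable section

open scoped TensorProduct NumberField Pointwise MatrixGroups Quaternion

namespace Literature.NumberTheory.Automorphic

/-! ### 1. A fundamental domain for the hull group `ι(O₀¹)` (every order, every real embedding) -/

section General

variable {B : Type*} [Ring B] [Algebra ℚ B] [IsQuaternionAlgebra ℚ B]

/-- **`ι = E(1 ⊗ ·)` for a real splitting `E`**: a `ℚ`-algebra map `ι : B → M₂(ℝ)` of a quaternion
algebra `B/ℚ` induces an `ℝ`-algebra isomorphism `E : ℝ ⊗_ℚ B ≃ M₂(ℝ)` with `ι x = E (1 ⊗ x)` (onto: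
`ℝ·ι(B) = M₂(ℝ)`, tree `span_real_range_eq_top`; into: equal dimension `4`).
[cite: VignerasLNM800, Ch. IV §1 (plongement H → H ⊗ ℝ ≅ M(2,ℝ))] -/
theorem exists_realSplitting_apply_eq_of_algHom (ι : B →ₐ[ℚ] Matrix (Fin 2) (Fin 2) ℝ) :
    ∃ E : ℝ ⊗[ℚ] B ≃ₐ[ℝ] Matrix (Fin 2) (Fin 2) ℝ, ∀ x, ι x = E ((1 : ℝ) ⊗ₜ[ℚ] x) := by
  let f : ℝ ⊗[ℚ] B →ₐ[ℝ] Matrix (Fin 2) (Fin 2) ℝ :=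
    Algebra.TensorProduct.lift (Algebra.ofId ℝ (Matrix (Fin 2) (Fin 2) ℝ)) ι
      (fun r b => Algebra.commutes r (ι b))
  have hf : ∀ x, f ((1 : ℝ) ⊗ₜ[ℚ] x) = ι x := fun x => by
    change Algebra.TensorProduct.lift _ _ _ ((1 : ℝ) ⊗ₜ[ℚ] x) = _
    rw [Algebra.TensorProduct.lift_tmul, map_one, one_mul]
  have hfin : Module.finrank ℝ (ℝ ⊗[ℚ] B) = Module.finrank ℝ (Matrix (Fin 2) (Fin 2) ℝ) := by
    rw [Module.finrank_baseChange, IsQuaternionAlgebra.finrank_eq_four (K := ℚ) (D := B),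
      Module.finrank_matrix]
    simp
  have hsurj : Function.Surjective f := by
    have h : ⊤ ≤ LinearMap.range f.toLinearMap := by
      rw [← span_real_range_eq_top ι, Submodule.span_le]
      rintro _ ⟨x, rfl⟩
      exact ⟨(1 : ℝ) ⊗ₜ[ℚ] x, hf x⟩
    exact LinearMap.range_eq_top.mp (top_le_iff.mp h)
  have hinj : Function.Injective f :=
    (LinearMap.injective_iff_surjective_of_finrank_eq_finrank hfin (f := f.toLinearMap)).mpr hsurj
  exact ⟨AlgEquiv.ofBijective f ⟨hinj, hsurj⟩, fun x => (hf x).symm⟩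

/-- **`ι(O¹)` is a discrete subgroup of `SL₂(ℝ)`** for every order `O` of a quaternion algebra `B/ℚ`
and every `ℚ`-algebra map `ι : B → M₂(ℝ)` (tree `isDiscreteSubgroup_normOneUnits_of_realSplitting`).
[cite: VignerasLNM800, Ch. IV §1 Thm. 1.1 (1)] -/
theorem isDiscreteSubgroup_normOneUnits_of_algHom (ι : B →ₐ[ℚ] Matrix (Fin 2) (Fin 2) ℝ)
    {O : Submodule ℤ B} (hO : Brandt.IsOrder B O) : IsDiscreteSubgroup (normOneUnits ι hO) := by
  obtain ⟨E, hE⟩ := exists_realSplitting_apply_eq_of_algHom ι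
  exact isDiscreteSubgroup_normOneUnits_of_realSplitting E ι hE hO

/-- **`ι(O¹) ∖ ℍ` has a measurable exact fundamental domain** for every order `O` and every real
embedding `ι` (tree `exists_isHypFundamentalDomain_of_isDiscreteSubgroup`).
[cite: VignerasLNM800, Ch. IV §2 (surfaces de Riemann Γ̄∖ℋ)] -/
theorem exists_isHypFundamentalDomain_normOneUnits_of_algHom (ι : B →ₐ[ℚ] Matrix (Fin 2) (Fin 2) ℝ)
    {O : Submodule ℤ B} (hO : Brandt.IsOrder B O) :
    ∃ F : Set UpperHalfPlane, IsHypFundamentalDomain (normOneUnits ι hO) F :=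
  exists_isHypFundamentalDomain_of_isDiscreteSubgroup (normOneUnits_le_range_toGL ι hO)
    (isDiscreteSubgroup_normOneUnits_of_algHom ι hO)

end General

namespace CartanLevelCurveData

variable {D M : ℕ} {C : Finset ℕ} (X : CartanLevelCurveData D M C)

/-- **The hull datum exists for every `C`**: the separate input `fd₀` of `X.toShimuraCurveData` — a
measurable exact fundamental domain of `ι(O₀¹)` — exists. [cite: VignerasLNM800, Ch. IV §1 Thm. 1.1 and §2] -/
theorem exists_isHypFundamentalDomain_hull :
    ∃ fd₀ : Set UpperHalfPlane, IsHypFundamentalDomain (normOneUnits X.ι X.isEichlerOrder.isOrder) fd₀ :=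
  exists_isHypFundamentalDomain_normOneUnits_of_algHom X.ι X.isEichlerOrder.isOrder

/-! ### 2. The Cartan order inside its hull: consequences of `saturated` and `isDivisionRing_mod` -/

/-- `nrd` takes integer values on the hull. [cite: VignerasLNM800, Ch. I §4 Lemme 4.12] -/
theorem exists_int_reducedNorm_eq_of_mem_hull {x : X.B} (hx : x ∈ X.O₀) :
    ∃ n : ℤ, reducedNorm ℚ X.B x = n := by
  obtain ⟨-, n, -, hn⟩ := X.isEichlerOrder.isOrder.exists_int_reducedTrace_reducedNorm hx
  exact ⟨n, hn⟩

/-- An element `x = q • y`, `y ∈ O₀`, has `q² ∣ nrd x` (`nrd (q y) = q² nrd y`, `nrd y ∈ ℤ`).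
[cite: VignerasLNM800, Ch. I §4 Lemme 4.12] -/
theorem sq_dvd_of_eq_smul {q : ℕ} {x y : X.B} (hy : y ∈ X.O₀) (hxy : x = (q : ℤ) • y) {n : ℤ}
    (hn : reducedNorm ℚ X.B x = n) : (q : ℤ) ^ 2 ∣ n := by
  obtain ⟨m, hm⟩ := X.exists_int_reducedNorm_eq_of_mem_hull hy
  refine ⟨m, ?_⟩
  have h : (n : ℚ) = ((q : ℤ) ^ 2 * m : ℤ) := by
    rw [← hn, hxy, ← Int.cast_smul_eq_zsmul ℚ, reducedNorm_smul, hm]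
    push_cast; ring
  exact_mod_cast h

/-- An element of `O₀` of reduced norm `ℓ` with `q² ∤ ℓ` is not in `q O₀`. [folklore] -/
private theorem not_exists_eq_smul_of_reducedNorm {q : ℕ} {x : X.B} {ℓ : ℤ}
    (hx : reducedNorm ℚ X.B x = ℓ) (hq : ¬ (q : ℤ) ^ 2 ∣ ℓ) :
    ¬ ∃ y ∈ X.O₀, x = (q : ℤ) • y := by
  rintro ⟨y, hy, hxy⟩
  exact hq (X.sq_dvd_of_eq_smul hy hxy hx)

/-- **Saturation lemma (injectivity of the coset comparison).** If `u ∈ O₀`, `x ∈ O` with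
`x ∉ q O₀` for every `q ∈ C`, and `u x ∈ O`, then `u ∈ O`: by `isDivisionRing_mod`, `x z - 1 = q y`
with `z ∈ O`, `y ∈ O₀`, so `u - (u x) z = q (-u y)` with `(u x) z ∈ O`, and `saturated` concludes.
[cite: KohenPacetti2016, §1.1 (non-split Cartan orders) and §1.3] -/
theorem mem_O_of_mul_mem {u x : X.B} (hu : u ∈ X.O₀) (hx : x ∈ X.O)
    (hxq : ∀ q ∈ C, ¬ ∃ y ∈ X.O₀, x = (q : ℤ) • y) (hux : u * x ∈ X.O) : u ∈ X.O := by
  refine X.saturated u hu fun q hq => ?_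
  obtain ⟨z, hz, y, hy, hxz⟩ := X.isDivisionRing_mod q hq x hx (hxq q hq)
  refine ⟨u * x * z, X.isOrder.mul_mem _ hux _ hz, -(u * y),
    X.O₀.neg_mem (X.isEichlerOrder.isOrder.mul_mem _ hu _ hy), ?_⟩
  have h : u * (x * z - 1) = u * ((q : ℤ) • y) := by rw [hxz]
  rw [mul_sub, mul_one, mul_smul_comm] at h
  rw [smul_neg, ← h]
  noncomm_ring

/-- **A hull unit of norm one matching two elements of `ι(O(ℓ))` lies in `Γ`.** For `ℓ` with
`q² ∤ ℓ` for all `q ∈ C` (e.g. a prime outside `C`): if `γ₀ ∈ Γ₀ = ι(O₀¹)` and `s, s' ∈ ι(O(ℓ))` with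
`γ₀ s = s'`, then `γ₀ ∈ Γ = ι(O¹)`. [cite: ShimuraIATAF1971, Prop. 3.36 and §3.3] -/
theorem mem_Gamma_of_mul_mem_heckeSet {ℓ : ℕ} (hℓ : ∀ q ∈ C, ¬ (q : ℤ) ^ 2 ∣ (ℓ : ℤ))
    {γ₀ : GL (Fin 2) ℝ} (hγ₀ : γ₀ ∈ normOneUnits X.ι X.isEichlerOrder.isOrder)
    {s s' : GL (Fin 2) ℝ} (hs : s ∈ X.heckeSet ℓ) (hs' : s' ∈ X.heckeSet ℓ) (h : γ₀ * s = s') :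
    γ₀ ∈ X.Gamma := by
  obtain ⟨⟨u, hu, huγ⟩, ⟨v, hv, hvγ⟩, hdet⟩ := hγ₀
  obtain ⟨⟨x, hx, hxs⟩, hdets⟩ := hs
  obtain ⟨⟨x', hx', hxs'⟩, hdets'⟩ := hs'
  -- norms
  have hnx : reducedNorm ℚ X.B x = (ℓ : ℤ) := by
    have h1 : ((reducedNorm ℚ X.B x : ℚ) : ℝ) = (ℓ : ℝ) := by
      rw [← eq_ratCast (algebraMap ℚ ℝ), ← AlgHom.det_eq_reducedNorm X.ι, hxs, hdets]
    exact_mod_cast h1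
  have hnx' : reducedNorm ℚ X.B x' = (ℓ : ℤ) := by
    have h1 : ((reducedNorm ℚ X.B x' : ℚ) : ℝ) = (ℓ : ℝ) := by
      rw [← eq_ratCast (algebraMap ℚ ℝ), ← AlgHom.det_eq_reducedNorm X.ι, hxs', hdets']
    exact_mod_cast h1
  -- `u x = x'`, `v u = 1`, `v x' = x`
  have hux : u * x = x' := X.ι_injective (by rw [map_mul, huγ, hxs, hxs', ← Units.val_mul, h])
  have hvu : v * u = 1 := X.ι_injective (by
    rw [map_mul, map_one, huγ, hvγ, ← Units.val_mul, inv_mul_cancel, Units.val_one])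
  have hvx' : v * x' = x := by rw [← hux, ← mul_assoc, hvu, one_mul]
  have huO : u ∈ X.O := X.mem_O_of_mul_mem hu hx
    (fun q hq => X.not_exists_eq_smul_of_reducedNorm hnx (hℓ q hq)) (hux ▸ hx')
  have hvO : v ∈ X.O := X.mem_O_of_mul_mem hv hx'
    (fun q hq => X.not_exists_eq_smul_of_reducedNorm hnx' (hℓ q hq)) (hvx' ▸ hx)
  exact ⟨⟨u, huO, huγ⟩, ⟨v, hvO, hvγ⟩, hdet⟩


/-! ### 3. Elements of `O` outside `ℤ + q O₀`, and what the division-ring field says about them -/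

/-- A cyclic-quotient bound: if `K ≤ A` are subgroups of an additive group, `g ∈ A` with `n • g ∈ K`
(`n ≠ 0`), and every `a ∈ A` is congruent to an integer multiple of `g` modulo `K`, then
`[A : K] ≤ n`. [folklore] -/
private theorem relIndex_le_of_forall_sub_zsmul_mem {G : Type*} [AddCommGroup G] {K A : AddSubgroup G}
    {g : G} (hg : g ∈ A) {n : ℕ} (hn : n ≠ 0) (hng : (n : ℤ) • g ∈ K)
    (hgen : ∀ a ∈ A, ∃ k : ℤ, a - k • g ∈ K) : K.relIndex A ≤ n := by
  classical
  rw [AddSubgroup.relIndex, AddSubgroup.index_eq_card]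
  set f : Fin n → A ⧸ K.addSubgroupOf A := fun i =>
    QuotientAddGroup.mk ⟨((i : ℕ) : ℤ) • g, A.zsmul_mem hg _⟩ with hf
  have hsurj : Function.Surjective f := by
    intro x
    obtain ⟨⟨a, ha⟩, rfl⟩ := QuotientAddGroup.mk_surjective x
    obtain ⟨k, hk⟩ := hgen a ha
    have hn' : (0 : ℤ) < n := by exact_mod_cast Nat.pos_of_ne_zero hn
    refine ⟨⟨(k % n).toNat, ?_⟩, ?_⟩
    · have := Int.emod_lt_of_pos k hn'
      omega
    · rw [hf]
      apply Eq.symm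
      rw [QuotientAddGroup.eq, AddSubgroup.mem_addSubgroupOf]
      change -a + ((((k % n).toNat : ℕ) : ℤ) • g) ∈ K
      have hcast : (((k % n).toNat : ℕ) : ℤ) = k % n := Int.toNat_of_nonneg (Int.emod_nonneg k hn'.ne')
      rw [hcast]
      have hk' : k % n = k - n * (k / n) := by rw [Int.emod_def]
      have : -a + (k % ↑n) • g = -(a - k • g) - (k / n) • ((n : ℤ) • g) := by
        rw [hk', sub_smul, smul_smul, mul_comm]; abel
      rw [this]
      exact K.sub_mem (K.neg_mem hk) (K.zsmul_mem hng _)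
  calc Nat.card (A ⧸ K.addSubgroupOf A) ≤ Nat.card (Fin n) := Nat.card_le_card_of_surjective f hsurj
    _ = n := by rw [Nat.card_eq_fintype_card, Fintype.card_fin]

/-- `[O₀ : q O₀] = q⁴` for the hull (`[I : α I] = nrd(α)²` with `α = q`, `nrd q = q²`).
[cite: VignerasLNM800, Ch. I §1 (N = n²)] -/
theorem relIndex_smul_hull {q : ℕ} (hq : q ≠ 0) :
    (((q : ℕ) : ℤ) • X.O₀).toAddSubgroup.relIndex X.O₀.toAddSubgroup = q ^ 4 := by
  haveI : Nontrivial X.B := Module.nontrivial_of_finrank_pos (R := ℚ)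
    (by rw [IsQuaternionAlgebra.finrank_eq_four (K := ℚ) (D := X.B)]; norm_num)
  have hunit : IsUnit (algebraMap ℚ X.B q) := (IsUnit.mk0 (q : ℚ) (by exact_mod_cast hq)).map _
  set α : (X.B)ˣ := hunit.unit with hα
  have hαval : (α : X.B) = algebraMap ℚ X.B q := hunit.unit_spec
  have key : ∀ y : X.B, (α : X.B) • y = ((q : ℕ) : ℤ) • y := fun y => by
    rw [smul_eq_mul, hαval, Algebra.algebraMap_eq_smul_one, smul_mul_assoc, one_mul,
      ← Int.cast_smul_eq_zsmul ℚ]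
    push_cast; rfl
  have hαO : (α : X.B) ∈ Brandt.leftOrder X.O₀ := by
    intro m hm
    rw [← smul_eq_mul, key]
    exact X.O₀.smul_mem _ hm
  have heq : (α • X.O₀ : Submodule ℤ X.B) = ((q : ℕ) : ℤ) • X.O₀ := by
    ext x
    rw [Units.smul_def, Submodule.mem_smul_pointwise_iff_exists, Submodule.mem_smul_pointwise_iff_exists]
    simp_rw [key]
  have h := Brandt.cast_relIndex_units_smul_eq_reducedNorm_sq X.isEichlerOrder.isOrder.isFullLattice hαO
  rw [heq, hαval, reducedNorm_algebraMap] at h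
  have h' : ((((q : ℕ) : ℤ) • X.O₀).toAddSubgroup.relIndex X.O₀.toAddSubgroup : ℚ) = ((q ^ 4 : ℕ) : ℚ) := by
    rw [h]; push_cast; ring
  exact_mod_cast h'

/-- **For every Cartan prime `q ∈ C` some `η ∈ O` lies outside `ℤ + q O₀`.** The index identity
`[O₀ : O] = ∏_{q'} q'²` gives `[O₀ : O + q² O₀] = q²` (`relIndex_sup_smul_eq`), so
`[O + q O₀ : q O₀] ≥ q⁴ / q² = q²`; but if `O ⊆ ℤ + q O₀` this quotient is cyclic, generated by `1`,
of order `≤ q`. (At `q` the Cartan order is `ℤ_{q²} + q O₀,q`, whose residue ring is the FIELD `𝔽_{q²}`,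
not `𝔽_q`.) [cite: KohenPacetti2016, §1.1 (non-split Cartan orders)] -/
theorem exists_mem_O_not_mem_int_add_smul {q : ℕ} (hq : q ∈ C) :
    ∃ η ∈ X.O, ∀ a : ℤ, ¬ ∃ y ∈ X.O₀, η - (a : ℤ) • (1 : X.B) = (q : ℤ) • y := by
  classical
  by_contra hcon
  push Not at hcon
  have hqp : q.Prime := (X.coprime q hq).1
  set K : Submodule ℤ X.B := ((q : ℕ) : ℤ) • X.O₀ with hK
  set R : Submodule ℤ X.B := X.O ⊔ K with hR
  have hKle : K ≤ X.O₀ := Submodule.smul_le_self_of_tower _ X.O₀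
  have hRle : R ≤ X.O₀ := sup_le X.le hKle
  have hKR : K ≤ R := le_sup_right
  -- the cofactor `N' = ∏_{q' ≠ q} q'`
  set N' : ℕ := ∏ q' ∈ C.erase q, q' with hN'
  have hN'0 : N' ≠ 0 := Finset.prod_ne_zero_iff.mpr fun q' hq' =>
    (X.coprime q' (Finset.mem_of_mem_erase hq')).1.ne_zero
  have hcop : Nat.Coprime q N' := by
    rw [hN']
    exact Nat.Coprime.prod_right fun q' hq' =>
      (Nat.coprime_primes hqp (X.coprime q' (Finset.mem_of_mem_erase hq')).1).mpr
        (Finset.ne_of_mem_erase hq').symm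
  have hidx : X.O.toAddSubgroup.relIndex X.O₀.toAddSubgroup = (q * N') ^ 2 := by
    rw [X.relIndex_eq, Finset.prod_pow, ← Finset.mul_prod_erase C (fun q' => q') hq]
  obtain ⟨h1, -⟩ := relIndex_sup_smul_eq X.le hqp.ne_zero hN'0 hcop hidx
  -- `[O₀ : R] ∣ q²`
  have hle2 : X.O ⊔ ((q ^ 2 : ℕ) : ℤ) • X.O₀ ≤ R := by
    refine sup_le le_sup_left fun x hx => ?_
    obtain ⟨y, hy, rfl⟩ := (Submodule.mem_smul_pointwise_iff_exists x _ X.O₀).mp hx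
    refine Submodule.mem_sup_right ((Submodule.mem_smul_pointwise_iff_exists _ _ X.O₀).mpr
      ⟨((q : ℕ) : ℤ) • y, X.O₀.smul_mem _ hy, ?_⟩)
    rw [smul_smul]; push_cast; ring_nf
  have hRdvd : R.toAddSubgroup.relIndex X.O₀.toAddSubgroup ∣ q ^ 2 := by
    rw [← h1]
    exact AddSubgroup.relIndex_dvd_of_le_left (L := X.O₀.toAddSubgroup) hle2
  -- `[R : K] · [O₀ : R] = q⁴`
  have hmul := AddSubgroup.relIndex_mul_relIndex K.toAddSubgroup R.toAddSubgroup X.O₀.toAddSubgroup hKR hRle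
  rw [X.relIndex_smul_hull hqp.ne_zero] at hmul
  -- hence `q² ≤ [R : K]`
  have hge : q ^ 2 ≤ K.toAddSubgroup.relIndex R.toAddSubgroup := by
    obtain ⟨c, hc⟩ := hRdvd
    have hc0 : c ≠ 0 := by
      rintro rfl
      rw [mul_zero] at hc
      exact pow_ne_zero 2 hqp.ne_zero hc
    have hq4 : K.toAddSubgroup.relIndex R.toAddSubgroup * q ^ 2 = q ^ 2 * c * q ^ 2 := by
      calc K.toAddSubgroup.relIndex R.toAddSubgroup * q ^ 2
          = K.toAddSubgroup.relIndex R.toAddSubgroup * (R.toAddSubgroup.relIndex X.O₀.toAddSubgroup * c) := by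
            rw [← hc]
        _ = q ^ 4 * c := by rw [← mul_assoc, hmul]
        _ = q ^ 2 * c * q ^ 2 := by ring
    have hKR_eq : K.toAddSubgroup.relIndex R.toAddSubgroup = q ^ 2 * c :=
      Nat.eq_of_mul_eq_mul_right (pow_pos hqp.pos 2) hq4
    rw [hKR_eq]
    exact Nat.le_mul_of_pos_right _ (Nat.pos_of_ne_zero hc0)
  -- but `[R : K] ≤ q`: `R/K` is generated by the class of `1`, killed by `q`
  have hle : K.toAddSubgroup.relIndex R.toAddSubgroup ≤ q := by
    refine relIndex_le_of_forall_sub_zsmul_mem (g := (1 : X.B))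
      (Submodule.mem_sup_left X.isOrder.one_mem) hqp.ne_zero
      (Submodule.smul_mem_pointwise_smul _ _ X.O₀ X.isEichlerOrder.isOrder.one_mem) ?_
    intro a ha
    obtain ⟨o, ho, k, hk, rfl⟩ := Submodule.mem_sup.mp ha
    obtain ⟨c, y, hy, hc⟩ := hcon o ho
    refine ⟨c, ?_⟩
    have : o + k - c • (1 : X.B) = (o - (c : ℤ) • 1) + k := by abel
    rw [this, hc]
    exact K.add_mem (Submodule.smul_mem_pointwise_smul y _ X.O₀ hy) hk
  have : q ^ 2 ≤ q := hge.trans hle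
  have hq2 : 2 ≤ q := hqp.two_le
  nlinarith

/-- If `w₁ ∈ O₀`, `w₂ ∈ O` with `w₂ ∉ q O₀` and `w₁ w₂ ∈ q O₀`, then `w₁ ∈ q O₀` — `w₂` is invertible
modulo `q O₀` by `isDivisionRing_mod`. [cite: KohenPacetti2016, §1.1] -/
theorem exists_eq_smul_of_mul {q : ℕ} (hq : q ∈ C) {w₁ w₂ : X.B} (hw₁ : w₁ ∈ X.O₀) (hw₂ : w₂ ∈ X.O)
    (hw₂q : ¬ ∃ y ∈ X.O₀, w₂ = (q : ℤ) • y) (h : ∃ y ∈ X.O₀, w₁ * w₂ = (q : ℤ) • y) :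
    ∃ y ∈ X.O₀, w₁ = (q : ℤ) • y := by
  obtain ⟨z, hz, y₁, hy₁, hzy⟩ := X.isDivisionRing_mod q hq w₂ hw₂ hw₂q
  obtain ⟨y, hy, hyw⟩ := h
  refine ⟨y * z - w₁ * y₁, X.O₀.sub_mem (X.isEichlerOrder.isOrder.mul_mem _ hy _ (X.le hz))
    (X.isEichlerOrder.isOrder.mul_mem _ hw₁ _ hy₁), ?_⟩
  have e : w₁ * (w₂ * z - 1) = w₁ * ((q : ℤ) • y₁) := by rw [hzy]
  rw [mul_sub, mul_one, ← mul_assoc, hyw, mul_smul_comm] at e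
  rw [smul_sub, ← e, smul_mul_assoc]
  abel

/-- `η² = t η − n` for `trd η = t`, `nrd η = n` (integer form of `x² = trd(x) x − nrd(x)`).
[cite: VignerasLNM800, Ch. I §1 Lemme 1.1] -/
theorem mul_self_eq_of_int {η : X.B} {t n : ℤ} (ht : reducedTrace ℚ X.B η = t)
    (hn : reducedNorm ℚ X.B η = n) : η * η = (t : ℤ) • η - (n : ℤ) • (1 : X.B) := by
  rw [mul_self_eq_reducedTrace_mul_sub_reducedNorm ℚ X.B η, ht, hn, Algebra.algebraMap_eq_smul_one,
    Algebra.algebraMap_eq_smul_one, smul_mul_assoc, one_mul, Int.cast_smul_eq_zsmul, Int.cast_smul_eq_zsmul]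

/-- **Trace and norm of `η ∈ O ∖ (ℤ + q O₀)`, odd `q`: `disc(η) = t² − 4n ≢ 0 (mod q)`.** Otherwise
`w = 2η − t` has `w² = t² − 4n ∈ q O₀` and `w ∉ q O₀`, contradicting the division-ring field (the
residue ring of the Cartan order at `q` is the field `𝔽_{q²}`, in which `η̄ ∉ 𝔽_q` generates).
[cite: KohenPacetti2016, §1.1] -/
theorem not_dvd_disc_of_not_mem {q : ℕ} (hq : q ∈ C) (hq2 : q ≠ 2) {η : X.B} (hη : η ∈ X.O)
    (hηq : ∀ a : ℤ, ¬ ∃ y ∈ X.O₀, η - (a : ℤ) • (1 : X.B) = (q : ℤ) • y) {t n : ℤ}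
    (ht : reducedTrace ℚ X.B η = t) (hn : reducedNorm ℚ X.B η = n) : ¬ (q : ℤ) ∣ t ^ 2 - 4 * n := by
  rintro ⟨k, hk⟩
  have hqp : q.Prime := (X.coprime q hq).1
  have hO₀ := X.isEichlerOrder.isOrder
  have hsq := X.mul_self_eq_of_int ht hn
  set w : X.B := (2 : ℤ) • η - (t : ℤ) • (1 : X.B) with hw
  have hwO : w ∈ X.O := X.O.sub_mem (X.O.smul_mem _ hη) (X.O.smul_mem _ X.isOrder.one_mem)
  have hww : w * w = (q : ℤ) • ((k : ℤ) • (1 : X.B)) := by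
    have e1 : w * w = (t ^ 2 - 4 * n : ℤ) • (1 : X.B) := by
      rw [hw]
      simp only [sub_mul, mul_sub, smul_mul_assoc, mul_smul_comm, one_mul, mul_one, hsq]
      module
    rw [e1, hk, smul_smul]
  -- `w ∉ q O₀`
  have hwq : ¬ ∃ y ∈ X.O₀, w = (q : ℤ) • y := by
    rintro ⟨y, hy, hwy⟩
    obtain ⟨m, hm⟩ : ∃ m : ℤ, (q : ℤ) = 2 * m - 1 := by
      obtain ⟨m, hm⟩ := hqp.eq_two_or_odd'.resolve_left hq2
      exact ⟨(m : ℤ) + 1, by rw [hm]; push_cast; ring⟩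
    apply hηq (m * t)
    refine ⟨m • y - η, X.O₀.sub_mem (X.O₀.smul_mem _ hy) (X.le hη), ?_⟩
    have e1 : (2 : ℤ) • η - (t : ℤ) • (1 : X.B) = (q : ℤ) • y := by rw [← hwy]
    rw [hm] at e1 ⊢
    linear_combination (norm := module) m • e1
  obtain ⟨y, hy, hwy⟩ := X.exists_eq_smul_of_mul hq (X.le hwO) hwO hwq
    ⟨(k : ℤ) • (1 : X.B), X.O₀.smul_mem _ hO₀.one_mem, hww⟩
  exact hwq ⟨y, hy, hwy⟩

/-- **Trace and norm of `η ∈ O ∖ (ℤ + 2 O₀)` at the Cartan prime `2`: both are odd** (the residue of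
`η` generates `𝔽₄ ⊂ M₂(𝔽₂)`, minimal polynomial `X² + X + 1`). [cite: KohenPacetti2016, §1.1] -/
theorem odd_trace_norm_of_not_mem (hq : 2 ∈ C) {η : X.B} (hη : η ∈ X.O)
    (hηq : ∀ a : ℤ, ¬ ∃ y ∈ X.O₀, η - (a : ℤ) • (1 : X.B) = ((2 : ℕ) : ℤ) • y) {t n : ℤ}
    (ht : reducedTrace ℚ X.B η = t) (hn : reducedNorm ℚ X.B η = n) : ¬ (2 : ℤ) ∣ t ∧ ¬ (2 : ℤ) ∣ n := by
  have hO₀ := X.isEichlerOrder.isOrder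
  have hsq := X.mul_self_eq_of_int ht hn
  constructor
  · -- `t` odd
    rintro ⟨s, hs⟩
    set w : X.B := η - (s : ℤ) • (1 : X.B) with hw
    have hwO : w ∈ X.O := X.O.sub_mem hη (X.O.smul_mem _ X.isOrder.one_mem)
    have hwq : ¬ ∃ y ∈ X.O₀, w = ((2 : ℕ) : ℤ) • y := hηq s
    have hww : w * w = (s ^ 2 - n : ℤ) • (1 : X.B) := by
      rw [hw]
      simp only [sub_mul, mul_sub, smul_mul_assoc, mul_smul_comm, one_mul, mul_one, hsq, hs]
      module
    rcases Int.even_or_odd (s ^ 2 - n) with ⟨k, hk⟩ | ⟨k, hk⟩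
    · -- `w² ∈ 2 O₀`
      have h2 : ∃ y ∈ X.O₀, w * w = ((2 : ℕ) : ℤ) • y :=
        ⟨(k : ℤ) • (1 : X.B), X.O₀.smul_mem _ hO₀.one_mem, by rw [hww, hk]; module⟩
      obtain ⟨y, hy, hwy⟩ := X.exists_eq_smul_of_mul hq (X.le hwO) hwO hwq h2
      exact hwq ⟨y, hy, hwy⟩
    · -- `w' = w − 1`, `w'² = w² − 2w + 1 ∈ 2 O₀`
      set w' : X.B := η - ((s + 1 : ℤ)) • (1 : X.B) with hw'
      have hw'O : w' ∈ X.O := X.O.sub_mem hη (X.O.smul_mem _ X.isOrder.one_mem)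
      have hw'q : ¬ ∃ y ∈ X.O₀, w' = ((2 : ℕ) : ℤ) • y := hηq (s + 1)
      have hw'w : w' = w - 1 := by rw [hw', hw, add_smul, one_smul]; abel
      have hww' : w' * w' = ((2 : ℕ) : ℤ) • (((k + 1 : ℤ)) • (1 : X.B) - w) := by
        have e1 : (w - 1) * (w - 1) = w * w - w - w + 1 := by noncomm_ring
        rw [hw'w, e1, hww, hk]
        module
      obtain ⟨y, hy, hwy⟩ := X.exists_eq_smul_of_mul hq (X.le hw'O) hw'O hw'q
        ⟨(k + 1 : ℤ) • (1 : X.B) - w, X.O₀.sub_mem (X.O₀.smul_mem _ hO₀.one_mem) (X.le hwO), hww'⟩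
      exact hw'q ⟨y, hy, hwy⟩
  · -- `n` odd
    rintro ⟨k, hk⟩
    set w₂ : X.B := η - (t : ℤ) • (1 : X.B) with hw₂
    have hw₂O : w₂ ∈ X.O := X.O.sub_mem hη (X.O.smul_mem _ X.isOrder.one_mem)
    have hw₂q : ¬ ∃ y ∈ X.O₀, w₂ = ((2 : ℕ) : ℤ) • y := hηq t
    have hprod : ∃ y ∈ X.O₀, η * w₂ = ((2 : ℕ) : ℤ) • y := by
      refine ⟨(-k : ℤ) • (1 : X.B), X.O₀.smul_mem _ hO₀.one_mem, ?_⟩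
      rw [hw₂, mul_sub, hsq, mul_smul_comm, mul_one, hk]
      module
    obtain ⟨y, hy, hηy⟩ := X.exists_eq_smul_of_mul hq (X.le hη) hw₂O hw₂q hprod
    exact hηq 0 ⟨y, hy, by rw [zero_smul, sub_zero, hηy]⟩


end CartanLevelCurveData

/-! ### 4. Norm residues: `nrd(c) · ℓ ≡ 1` for some `c ∈ ℤ[η] ⊆ O` -/

section NormResidues

/-- An integral binary quadratic form `a² + t a b + n b²` whose discriminant `t² − 4n` is prime to the
odd prime `q` represents, after multiplication by any `ℓ` prime to `q`, the class of `1` modulo `q`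
(`4(a² + tab + nb²) = (2a + tb)² − (t² − 4n) b²`, and `U² − Δ V²` takes every value mod `q`; Mathlib
`FiniteField.exists_root_sum_quadratic`). [folklore] -/
private theorem exists_binaryForm_mul_eq_one_add {q : ℕ} (hqp : q.Prime) (hq2 : q ≠ 2) {t n : ℤ}
    (hdisc : ¬ (q : ℤ) ∣ t ^ 2 - 4 * n) {ℓ : ℤ} (hℓ : ¬ (q : ℤ) ∣ ℓ) :
    ∃ a b k : ℤ, (a ^ 2 + t * a * b + n * b ^ 2) * ℓ = 1 + q * k := by
  haveI : Fact q.Prime := ⟨hqp⟩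
  have h2 : (2 : ZMod q) ≠ 0 := by
    intro h
    have h' : ((2 : ℕ) : ZMod q) = 0 := by exact_mod_cast h
    rw [ZMod.natCast_eq_zero_iff] at h'
    exact hq2 ((Nat.prime_dvd_prime_iff_eq hqp Nat.prime_two).mp h')
  set Δ : ZMod q := ((t ^ 2 - 4 * n : ℤ) : ZMod q) with hΔ
  have hΔ0 : Δ ≠ 0 := by
    intro h
    exact hdisc ((ZMod.intCast_zmod_eq_zero_iff_dvd _ q).mp h)
  have hℓ0 : ((ℓ : ℤ) : ZMod q) ≠ 0 := fun h => hℓ ((ZMod.intCast_zmod_eq_zero_iff_dvd _ q).mp h)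
  set r : ZMod q := ((ℓ : ℤ) : ZMod q)⁻¹ with hr
  -- `U² − Δ V² = 4 r`
  let f : Polynomial (ZMod q) := Polynomial.X ^ 2
  let g : Polynomial (ZMod q) := Polynomial.C (-Δ) * Polynomial.X ^ 2 - Polynomial.C (4 * r)
  have hg2 : g.degree = 2 := by
    have hd : (Polynomial.C (-Δ) * Polynomial.X ^ 2 : Polynomial (ZMod q)).degree = 2 := by
      rw [Polynomial.degree_C_mul_X_pow 2 (neg_ne_zero.mpr hΔ0)]; rfl
    rw [show g = Polynomial.C (-Δ) * Polynomial.X ^ 2 - Polynomial.C (4 * r) from rfl,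
      Polynomial.degree_sub_C (by rw [hd]; norm_num), hd]
  obtain ⟨U, V, hUV⟩ := FiniteField.exists_root_sum_quadratic (f := f) (g := g) (Polynomial.degree_X_pow 2)
    hg2 (by rw [ZMod.card]; exact hqp.eq_two_or_odd.resolve_left hq2)
  simp only [f, g, Polynomial.eval_sub, Polynomial.eval_mul, Polynomial.eval_C, Polynomial.eval_pow,
    Polynomial.eval_X] at hUV
  -- `a = (U − t V)/2`, `b = V`
  set i2 : ZMod q := (2 : ZMod q)⁻¹ with hi2
  have h2i : 2 * i2 = 1 := mul_inv_cancel₀ h2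
  set A : ZMod q := i2 * (U - (t : ZMod q) * V) with hA
  have hform : A ^ 2 + (t : ZMod q) * A * V + (n : ZMod q) * V ^ 2 = r := by
    have h4 : (4 : ZMod q) ≠ 0 := by
      rw [show (4 : ZMod q) = 2 * 2 by norm_num]; exact mul_ne_zero h2 h2
    apply mul_left_cancel₀ h4
    have hΔ' : Δ = (t : ZMod q) ^ 2 - 4 * (n : ZMod q) := by rw [hΔ]; push_cast; ring
    rw [hΔ'] at hUV
    linear_combination hUV + ((2 * i2 + 1) * (U - (t : ZMod q) * V) ^ 2 +
      2 * (t : ZMod q) * (U - (t : ZMod q) * V) * V) * h2i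
  -- integer representatives
  refine ⟨(A.val : ℤ), (V.val : ℤ), ?_⟩
  have hcast : (((((A.val : ℤ)) ^ 2 + t * (A.val : ℤ) * (V.val : ℤ) + n * (V.val : ℤ) ^ 2) * ℓ - 1 : ℤ) :
      ZMod q) = 0 := by
    push_cast
    simp only [ZMod.natCast_zmod_val]
    rw [hform, hr, inv_mul_cancel₀ hℓ0, sub_self]
  obtain ⟨k, hk⟩ := (ZMod.intCast_zmod_eq_zero_iff_dvd _ q).mp hcast
  exact ⟨k, by linear_combination hk⟩

/-- The `mod 8` table behind the `2`-adic refinement: for odd `t` (i.e. `t² ≡ 1 (mod 8)`) the map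
`j ↦ j t + 2 j²` hits every class modulo `8`. [folklore] -/
private theorem zmod8_table : ∀ t s : ZMod 8, t * t = 1 → ∃ j : ZMod 8, j * t + 2 * j * j = s := by
  decide

/-- Odd squares are `1 (mod 8)`. [folklore] -/
private theorem zmod8_odd_sq : ∀ i : ZMod 8, (2 * i + 1) * (2 * i + 1) = 1 := by decide

/-- Odd fourth powers are `1 (mod 16)`. [folklore] -/
private theorem zmod16_odd_pow_four : ∀ i : ZMod 16, (2 * i + 1) ^ 4 = 1 := by decide

/-- The `2`-adic refinement: for odd `t, n, ℓ` some EVEN integer `m` has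
`(n + m t + m²) · ℓ ≡ 1 (mod 16)` (`n + m t + m² = nrd(η + m)` for `trd η = t`, `nrd η = n`).
[folklore] -/
private theorem exists_even_normShift_mul_eq_one_add {t n ℓ : ℤ} (ht : ¬ (2 : ℤ) ∣ t) (hn : ¬ (2 : ℤ) ∣ n)
    (hℓ : ¬ (2 : ℤ) ∣ ℓ) : ∃ m k : ℤ, (2 : ℤ) ∣ m ∧ (n + m * t + m ^ 2) * ℓ = 1 + 16 * k := by
  obtain ⟨t', ht'⟩ := Int.not_even_iff_odd.mp (fun h => ht (even_iff_two_dvd.mp h))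
  obtain ⟨n', hn'⟩ := Int.not_even_iff_odd.mp (fun h => hn (even_iff_two_dvd.mp h))
  obtain ⟨l', hl'⟩ := Int.not_even_iff_odd.mp (fun h => hℓ (even_iff_two_dvd.mp h))
  -- `ℓ³ − n = 2 s₀`
  obtain ⟨s₀, hs₀⟩ : (2 : ℤ) ∣ ℓ ^ 3 - n := ⟨4 * l' ^ 3 + 6 * l' ^ 2 + 3 * l' - n', by rw [hl', hn']; ring⟩
  -- `t² ≡ 1 (mod 8)`
  have htt : ((t : ℤ) : ZMod 8) * (t : ZMod 8) = 1 := by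
    have := zmod8_odd_sq (t' : ZMod 8)
    rw [ht']; push_cast; exact this
  obtain ⟨j₀, hj₀⟩ := zmod8_table (t : ZMod 8) (s₀ : ZMod 8) htt
  set j : ℤ := (j₀.val : ℤ) with hj
  have hj8 : ((j * t + 2 * j * j - s₀ : ℤ) : ZMod 8) = 0 := by
    rw [hj]
    push_cast
    simp only [ZMod.natCast_zmod_val]
    rw [hj₀, sub_self]
  obtain ⟨e, he⟩ := (ZMod.intCast_zmod_eq_zero_iff_dvd _ 8).mp hj8
  -- `ℓ⁴ ≡ 1 (mod 16)`
  have hl16 : (((ℓ ^ 4 - 1 : ℤ)) : ZMod 16) = 0 := by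
    have := zmod16_odd_pow_four (l' : ZMod 16)
    rw [hl']; push_cast; rw [this, sub_self]
  obtain ⟨e', he'⟩ := (ZMod.intCast_zmod_eq_zero_iff_dvd _ 16).mp hl16
  refine ⟨2 * j, e * ℓ + e', ⟨j, rfl⟩, ?_⟩
  linear_combination (2 * ℓ) * he + he' - ℓ * hs₀

end NormResidues

namespace CartanLevelCurveData

variable {D M : ℕ} {C : Finset ℕ} (X : CartanLevelCurveData D M C)

/-- `nrd(a + b η) = a² + t a b + n b²` for `trd η = t`, `nrd η = n` (the norm form of `ℤ[η]`).
[cite: VignerasLNM800, Ch. I §1 Lemme 1.1] -/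
theorem reducedNorm_int_add_int_smul {η : X.B} {t n : ℤ} (ht : reducedTrace ℚ X.B η = t)
    (hn : reducedNorm ℚ X.B η = n) (a b : ℤ) :
    reducedNorm ℚ X.B ((a : ℤ) • (1 : X.B) + (b : ℤ) • η) = (a ^ 2 + t * a * b + n * b ^ 2 : ℤ) := by
  rw [reducedNorm_add ℚ, ← Int.cast_smul_eq_zsmul ℚ a, ← Int.cast_smul_eq_zsmul ℚ b, reducedNorm_smul,
    reducedNorm_smul, reducedNorm_one ℚ X.B, hn, standardInvolution_smul, smul_mul_smul_comm, one_mul,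
    map_smul, reducedTrace_standardInvolution, ht, smul_eq_mul]
  push_cast; ring

/-- `nrd(η + m) = n + m t + m²` for `trd η = t`, `nrd η = n`. [cite: VignerasLNM800, Ch. I §1 Lemme 1.1] -/
theorem reducedNorm_add_int_smul {η : X.B} {t n : ℤ} (ht : reducedTrace ℚ X.B η = t)
    (hn : reducedNorm ℚ X.B η = n) (m : ℤ) :
    reducedNorm ℚ X.B (η + (m : ℤ) • (1 : X.B)) = (n + m * t + m ^ 2 : ℤ) := by
  have h := X.reducedNorm_int_add_int_smul ht hn m 1
  rw [one_smul, add_comm] at h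
  rw [h]; push_cast; ring

/-- **Norm residues at a Cartan prime.** For `q ∈ C` and a prime `ℓ ≠ q` there is `c ∈ O` with
`nrd(c) · ℓ ≡ 1 (mod q)` — and `(mod 16)` when `q = 2` — namely `c ∈ ℤ[η_q]` for an `η_q ∈ O` whose
residue generates the field `𝔽_{q²}` (the norm `𝔽_{q²}^× → 𝔽_q^×` is onto). [cite: KohenPacetti2016, §1.1] -/
theorem exists_mem_O_reducedNorm_mul_eq {q : ℕ} (hq : q ∈ C) {ℓ : ℕ} (hℓ : ℓ.Prime) (hqℓ : q ≠ ℓ) :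
    ∃ c ∈ X.O, ∃ k : ℤ,
      reducedNorm ℚ X.B c * ℓ = 1 + ((if q = 2 then 16 else q : ℕ) : ℚ) * k := by
  have hqp : q.Prime := (X.coprime q hq).1
  obtain ⟨η, hη, hηq⟩ := X.exists_mem_O_not_mem_int_add_smul hq
  obtain ⟨t, n, ht, hn⟩ := X.isOrder.exists_int_reducedTrace_reducedNorm hη
  have hqℓ' : ¬ (q : ℤ) ∣ (ℓ : ℤ) := by
    intro h
    have : q ∣ ℓ := by exact_mod_cast h
    exact hqℓ ((Nat.prime_dvd_prime_iff_eq hqp hℓ).mp this)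
  by_cases hq2 : q = 2
  · subst hq2
    obtain ⟨hto, hno⟩ := X.odd_trace_norm_of_not_mem hq hη hηq ht hn
    obtain ⟨m, k, -, hmk⟩ := exists_even_normShift_mul_eq_one_add hto hno hqℓ'
    refine ⟨η + (m : ℤ) • (1 : X.B), X.O.add_mem hη (X.O.smul_mem _ X.isOrder.one_mem), k, ?_⟩
    rw [X.reducedNorm_add_int_smul ht hn m, if_pos rfl]
    exact_mod_cast hmk
  · have hdisc := X.not_dvd_disc_of_not_mem hq hq2 hη hηq ht hn
    obtain ⟨a, b, k, habk⟩ := exists_binaryForm_mul_eq_one_add hqp hq2 hdisc hqℓ'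
    refine ⟨(a : ℤ) • (1 : X.B) + (b : ℤ) • η,
      X.O.add_mem (X.O.smul_mem _ X.isOrder.one_mem) (X.O.smul_mem _ hη), k, ?_⟩
    rw [X.reducedNorm_int_add_int_smul ht hn a b, if_neg hq2]
    exact_mod_cast habk

/-! ### 5. Surjectivity: a norm-one hull unit carrying `x₀ ∈ O₀(ℓ)` into `O` -/

/-- The congruence lattice `Λ = {x ∈ O₀ : x ∈ ℤ τ_q + q O₀ for all q ∈ C}` is a `ℤ`-submodule. [folklore] -/
private theorem exists_congrLattice (τ : ℕ → X.B) :
    ∃ Λ : Submodule ℤ X.B, ∀ x, x ∈ Λ ↔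
      (x ∈ X.O₀ ∧ ∀ q ∈ C, ∃ c : ℤ, ∃ y ∈ X.O₀, x - c • τ q = (q : ℤ) • y) := by
  refine ⟨{ carrier := {x | x ∈ X.O₀ ∧ ∀ q ∈ C, ∃ c : ℤ, ∃ y ∈ X.O₀, x - c • τ q = (q : ℤ) • y}
            add_mem' := ?_, zero_mem' := ?_, smul_mem' := ?_ }, fun x => Iff.rfl⟩
  · rintro x x' ⟨hx, hx'⟩ ⟨hy, hy'⟩
    refine ⟨X.O₀.add_mem hx hy, fun q hq => ?_⟩
    obtain ⟨c, y, hyO, hc⟩ := hx' q hq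
    obtain ⟨c', y', hy'O, hc'⟩ := hy' q hq
    refine ⟨c + c', y + y', X.O₀.add_mem hyO hy'O, ?_⟩
    rw [smul_add, ← hc, ← hc', add_smul]; abel
  · exact ⟨X.O₀.zero_mem, fun q hq => ⟨0, 0, X.O₀.zero_mem, by simp⟩⟩
  · rintro m x ⟨hx, hx'⟩
    refine ⟨X.O₀.smul_mem m hx, fun q hq => ?_⟩
    obtain ⟨c, y, hyO, hc⟩ := hx' q hq
    refine ⟨m * c, m • y, X.O₀.smul_mem m hyO, ?_⟩
    rw [← smul_smul, ← smul_sub, hc, smul_comm]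

/-- **SURJECTIVITY of the coset comparison.** For a prime `ℓ ∉ C` and `x₀ ∈ O₀` of reduced norm `ℓ`
there is a hull unit `u ∈ O₀` of reduced norm `1` with `u x₀ ∈ O` (Eichler–Kneser strong
approximation for `O₀¹` with congruence conditions at the Cartan primes, lattice form; see the module
docstring). [cite: VignerasLNM800, Ch. III §4 Thm. 4.3 and §5 Cor. 5.7] [cite: ShimuraIATAF1971, Prop. 3.36] -/
theorem exists_normOne_mul_mem {ℓ : ℕ} (hℓ : ℓ.Prime) (hℓC : ∀ q ∈ C, q ≠ ℓ) {x₀ : X.B}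
    (hx₀ : x₀ ∈ X.O₀) (hn₀ : reducedNorm ℚ X.B x₀ = ℓ) :
    ∃ u ∈ X.O₀, reducedNorm ℚ X.B u = 1 ∧ u * x₀ ∈ X.O := by
  classical
  have hO₀ : Brandt.IsOrder X.B X.O₀ := X.isEichlerOrder.isOrder
  have hprime : ∀ q ∈ C, q.Prime := fun q hq => (X.coprime q hq).1
  -- the moduli `M_q` and the data `c_q`
  set Mq : ℕ → ℕ := fun q => if q = 2 then 16 else q with hMq
  have hdata : ∀ q : ℕ, ∃ c : X.B, ∃ k : ℤ, q ∈ C →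
      (c ∈ X.O ∧ reducedNorm ℚ X.B c * ℓ = 1 + ((Mq q : ℕ) : ℚ) * k) := by
    intro q
    by_cases hq : q ∈ C
    · obtain ⟨c, hc, k, hk⟩ := X.exists_mem_O_reducedNorm_mul_eq hq hℓ (hℓC q hq)
      exact ⟨c, k, fun _ => ⟨hc, hk⟩⟩
    · exact ⟨0, 0, fun h => absurd h hq⟩
  choose c k hck using hdata
  -- `τ_q = c_q · x̄₀`
  set xb : X.B := standardInvolution ℚ X.B x₀ with hxb
  have hxbO : xb ∈ X.O₀ := hO₀.standardInvolution_mem hx₀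
  set τ : ℕ → X.B := fun q => c q * xb with hτ
  have hτO : ∀ q ∈ C, τ q ∈ X.O₀ := fun q hq => hO₀.mul_mem _ (X.le (hck q hq).1) _ hxbO
  have hτx : ∀ q ∈ C, τ q * x₀ = (ℓ : ℤ) • c q := fun q hq => by
    rw [hτ]
    change c q * xb * x₀ = _
    rw [mul_assoc, hxb, IsQuaternionAlgebra.standardInvolution_mul (K := ℚ), hn₀,
      Algebra.algebraMap_eq_smul_one, mul_smul_comm, mul_one, ← Int.cast_smul_eq_zsmul ℚ]
    push_cast; rfl
  have hτn : ∀ q ∈ C, reducedNorm ℚ X.B (τ q) = 1 + ((Mq q : ℕ) : ℚ) * k q := fun q hq => by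
    rw [hτ]
    change reducedNorm ℚ X.B (c q * xb) = _
    rw [reducedNorm_mul_holds ℚ X.B, hxb, reducedNorm_standardInvolution, hn₀]
    exact (hck q hq).2
  -- the lattice
  obtain ⟨Λ, hΛ⟩ := X.exists_congrLattice τ
  set N : ℕ := ∏ q ∈ C, q with hN
  have hN0 : N ≠ 0 := Finset.prod_ne_zero_iff.mpr fun q hq => (hprime q hq).ne_zero
  have hΛle : Λ ≤ X.O₀ := fun x hx => ((hΛ x).mp hx).1
  have hNmem : ∀ x ∈ X.O₀, ((N : ℕ) : ℤ) • x ∈ Λ := by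
    intro x hx
    refine (hΛ _).mpr ⟨X.O₀.smul_mem _ hx, fun q hq => ?_⟩
    obtain ⟨m, hm⟩ : q ∣ N := Finset.dvd_prod_of_mem _ hq
    refine ⟨0, (m : ℤ) • x, X.O₀.smul_mem _ hx, ?_⟩
    rw [zero_smul, sub_zero, hm, Nat.cast_mul, ← smul_smul]
  have hΛfull : IsFullLattice X.B Λ :=
    isFullLattice_of_between hO₀.isFullLattice hΛle (m := ((N : ℕ) : ℤ)) (by exact_mod_cast hN0) hNmem
  -- an integral model `H = ℍ[ℚ,a,b]` of `X.B`
  obtain ⟨a, b, ha, hb, ⟨e⟩⟩ :=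
    QuaternionAlgebra.exists_algEquiv_quaternionAlgebra_integers (K := ℚ) (D := X.B)
  have hinjO := FaithfulSMul.algebraMap_injective (𝓞 ℚ) ℚ
  haveI : IsQuaternionAlgebra ℚ ℍ[ℚ,algebraMap (𝓞 ℚ) ℚ a,algebraMap (𝓞 ℚ) ℚ b] :=
    QuaternionAlgebra.isQuaternionAlgebra_holds ((map_ne_zero_iff _ hinjO).mpr ha)
      ((map_ne_zero_iff _ hinjO).mpr hb)
  set ΛH : Submodule ℤ ℍ[ℚ,algebraMap (𝓞 ℚ) ℚ a,algebraMap (𝓞 ℚ) ℚ b] :=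
    Λ.map (e.toRingEquiv.toAddEquiv.toIntLinearEquiv :
      X.B →ₗ[ℤ] ℍ[ℚ,algebraMap (𝓞 ℚ) ℚ a,algebraMap (𝓞 ℚ) ℚ b]) with hΛH
  have hΛHfull : IsFullLattice _ ΛH := hΛfull.map_ringEquiv e.toRingEquiv
  have hdef : ¬ IsTotallyDefinite ℚ ℍ[ℚ,algebraMap (𝓞 ℚ) ℚ a,algebraMap (𝓞 ℚ) ℚ b] := by
    obtain ⟨v⟩ : Nonempty (NumberField.InfinitePlace ℚ) := inferInstance
    exact fun h => h v (isSplitAtInfinite_of_algHom_real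
      (X.ι.comp (e.symm : ℍ[ℚ,algebraMap (𝓞 ℚ) ℚ a,algebraMap (𝓞 ℚ) ℚ b] →ₐ[ℚ] X.B)) v)
  have hmemH : ∀ z : X.B, e z ∈ ΛH ↔ z ∈ Λ := fun z => by
    rw [hΛH, mem_map_ringEquiv_iff]
    change e.symm (e z) ∈ Λ ↔ z ∈ Λ
    rw [e.symm_apply_apply]
  -- local points of norm `≡ 1 (mod 8p)`
  have hloc : ∀ p : ℕ, p.Prime → ∃ z ∈ localAt p ΛH, ∃ d : ℚ, padicNorm p d < 1 ∧
      z * star z = algebraMap ℚ _ (1 + 8 * d) := by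
    intro p hp
    haveI : Fact p.Prime := ⟨hp⟩
    by_cases hpC : p ∈ C
    · -- the cofactor `N' = ∏_{q ≠ p} q`, inverted modulo `M_p`
      set N' : ℕ := ∏ q ∈ C.erase p, q with hN'
      have hNN' : N = p * N' := by rw [hN, hN', Finset.mul_prod_erase C (fun q => q) hpC]
      have hcopM : Nat.Coprime N' (Mq p) := by
        rw [hN']
        refine Nat.Coprime.prod_left fun q hq => ?_
        have hqC := Finset.mem_of_mem_erase hq
        have hqp' : q ≠ p := Finset.ne_of_mem_erase hq
        by_cases hp2 : p = 2
        · rw [hMq]; simp only [hp2, if_true]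
          have hq2 : q ≠ 2 := hp2 ▸ hqp'
          exact Nat.Coprime.pow_right 4 ((Nat.coprime_primes (hprime q hqC) Nat.prime_two).mpr hq2)
        · rw [hMq]; simp only [hp2, if_false]
          exact (Nat.coprime_primes (hprime q hqC) hp).mpr hqp'
      obtain ⟨mu, mv, hmuv⟩ : IsCoprime (N' : ℤ) ((Mq p : ℕ) : ℤ) := Nat.isCoprime_iff_coprime.mpr hcopM
      -- `w = N' mu = 1 + M_p j`
      set w : ℤ := (N' : ℤ) * mu with hw
      have hwj : w = 1 + ((Mq p : ℕ) : ℤ) * (-mv) := by rw [hw]; linear_combination hmuv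
      set z : X.B := w • τ p with hz
      -- `z ∈ Λ`
      have hzΛ : z ∈ Λ := by
        refine (hΛ z).mpr ⟨X.O₀.smul_mem _ (hτO p hpC), fun q hq => ?_⟩
        by_cases hqp' : q = p
        · subst hqp'
          exact ⟨w, 0, X.O₀.zero_mem, by rw [hz, sub_self, smul_zero]⟩
        · obtain ⟨m, hm⟩ : q ∣ N' := Finset.dvd_prod_of_mem _ (Finset.mem_erase.mpr ⟨hqp', hq⟩)
          refine ⟨0, ((m : ℤ) * mu) • τ p, X.O₀.smul_mem _ (hτO p hpC), ?_⟩
          rw [zero_smul, sub_zero, hz, hw, hm, smul_smul]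
          push_cast; ring_nf
      -- its norm
      have hnz : reducedNorm ℚ X.B z = (w : ℚ) ^ 2 * (1 + ((Mq p : ℕ) : ℚ) * k p) := by
        rw [hz, ← Int.cast_smul_eq_zsmul ℚ, reducedNorm_smul, hτn p hpC]
      set E : ℚ := ((k p + 2 * (-mv) + 2 * ((Mq p : ℕ) : ℤ) * (-mv) * k p + ((Mq p : ℕ) : ℤ) * (-mv) ^ 2 +
        ((Mq p : ℕ) : ℤ) ^ 2 * (-mv) ^ 2 * k p : ℤ) : ℚ) with hE
      have hnz' : reducedNorm ℚ X.B z = 1 + ((Mq p : ℕ) : ℚ) * E := by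
        rw [hnz, hwj, hE]; push_cast; ring
      refine ⟨e z, le_localAt p ΛH ((hmemH z).mpr hzΛ), ((Mq p : ℕ) : ℚ) * E / 8, ?_, ?_⟩
      · -- `|M_p E / 8|_p < 1`
        have hEint : padicNorm p E ≤ 1 := by rw [hE]; exact padicNorm.of_int _
        by_cases hp2 : p = 2
        · subst hp2
          have hM : ((Mq 2 : ℕ) : ℚ) = 16 := by rw [hMq]; simp
          rw [hM, show (16 : ℚ) * E / 8 = 2 * E by ring, padicNorm.mul,
            show (2 : ℚ) = ((2 : ℕ) : ℚ) by norm_num, padicNorm.padicNorm_p_of_prime]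
          calc (↑(2 : ℕ) : ℚ)⁻¹ * padicNorm 2 E ≤ (↑(2 : ℕ) : ℚ)⁻¹ * 1 := by gcongr
            _ < 1 := by norm_num
        · have hM : ((Mq p : ℕ) : ℚ) = p := by rw [hMq]; simp [hp2]
          have h8 : ¬ p ∣ 8 := fun h8 =>
            hp2 ((Nat.prime_dvd_prime_iff_eq hp Nat.prime_two).mp (hp.dvd_of_dvd_pow (show p ∣ 2 ^ 3 from h8)))
          have h8' : padicNorm p (8 : ℚ) = 1 := by exact_mod_cast (padicNorm.nat_eq_one_iff (p := p) 8).mpr h8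
          rw [hM, padicNorm.div, padicNorm.mul, h8', div_one, padicNorm.padicNorm_p_of_prime]
          calc (p : ℚ)⁻¹ * padicNorm p E ≤ (p : ℚ)⁻¹ * 1 := by gcongr
            _ < 1 := by rw [mul_one]; exact inv_lt_one_of_one_lt₀ (by exact_mod_cast hp.one_lt)
      · rw [QuaternionAlgebra.mul_star_self_eq_algebraMap_reducedNorm ℚ (e z), reducedNorm_algEquiv e z, hnz']
        congr 1
        ring
    · -- `z = 1 ∈ Λ₍ₚ₎` since `N · 1 ∈ Λ` with `p ∤ N`
      refine ⟨1, mem_localAt_iff.mpr ⟨N, hN0, ?_, ?_⟩, 0, by simp, by simp⟩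
      · rw [hN]
        exact Nat.Coprime.prod_left fun q hq => (Nat.coprime_primes (hprime q hq) hp).mpr fun hqp =>
          hpC (hqp ▸ hq)
      · have h1 := (hmemH _).mpr (hNmem 1 hO₀.one_mem)
        rwa [map_zsmul, map_one] at h1
  -- a norm-one point of `Λ`
  obtain ⟨xH, hxΛ, hx1⟩ := QuaternionAlgebra.exists_mem_mul_star_eq_one a b ha hb hdef hΛHfull hloc
  set u : X.B := e.symm xH with hu
  have huΛ : u ∈ Λ := (mem_map_ringEquiv_iff e.toRingEquiv).mp hxΛ
  have hnu : reducedNorm ℚ X.B u = 1 := by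
    have h := (QuaternionAlgebra.mul_star_self_eq_one_iff ℚ xH).mp hx1
    rwa [← e.apply_symm_apply xH, reducedNorm_algEquiv e] at h
  obtain ⟨huO, hures⟩ := (hΛ u).mp huΛ
  refine ⟨u, huO, hnu, ?_⟩
  -- `u x₀ ∈ O` by saturation
  refine X.saturated (u * x₀) (hO₀.mul_mem _ huO _ hx₀) fun q hq => ?_
  obtain ⟨cz, y, hy, hcy⟩ := hures q hq
  refine ⟨cz • ((ℓ : ℤ) • c q), X.O.smul_mem _ (X.O.smul_mem _ (hck q hq).1), y * x₀,
    hO₀.mul_mem _ hy _ hx₀, ?_⟩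
  have h := congrArg (· * x₀) hcy
  simp only [sub_mul, smul_mul_assoc] at h
  rw [hτx q hq] at h
  exact h


/-! ### 6. The coset comparison `Γ ∖ ι(O(ℓ)) ≃ Γ₀ ∖ ι(O₀(ℓ))` -/

/-- `Γ ≤ Γ₀`: the Cartan curve covers the Eichler curve under it (`O ≤ O₀`; Kohen–Pacetti's
`Γ_ns^ε(N) ∩ Γ₀(m) ≤ Γ₀(m)`). [cite: KohenPacetti2016, §2 (the groups Γ_ns^ε(N) ∩ Γ₀(m))] -/
theorem gamma_le_normOneUnits_hull : X.Gamma ≤ normOneUnits X.ι X.isEichlerOrder.isOrder := by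
  rintro γ ⟨⟨x, hx, hxg⟩, ⟨y, hy, hyg⟩, hdet⟩
  exact ⟨⟨x, X.le hx, hxg⟩, ⟨y, X.le hy, hyg⟩, hdet⟩

/-- **THE COSET COMPARISON IS A BIJECTION.** For a prime `ℓ` which is not a Cartan prime, the map
`Γ ∖ ι(O(ℓ)) → Γ₀ ∖ ι(O₀(ℓ))` induced by the inclusions `ι(O(ℓ)) ⊆ ι(O₀(ℓ))`, `Γ ≤ Γ₀` (to the Eichler
datum `X.toShimuraCurveData fd₀ h` under `X`) is a bijection: injective by
`mem_Gamma_of_mul_mem_heckeSet`, surjective by `exists_normOne_mul_mem`. (Shimura 1971 Prop. 3.36: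
`deg Γ'αΓ' = deg ΓαΓ` for an intermediate group of level prime to `det α`.)
[cite: ShimuraIATAF1971, Prop. 3.36 and §3.3] [cite: KohenPacetti2016, §1.3] -/
theorem nonempty_quotient_heckeSetoid_equiv_hull (fd₀ : Set UpperHalfPlane)
    (h₀ : IsHypFundamentalDomain (normOneUnits X.ι X.isEichlerOrder.isOrder) fd₀)
    {ℓ : ℕ} (hℓ : ℓ.Prime) (hℓC : ∀ q ∈ C, q ≠ ℓ) :
    Nonempty (Quotient (X.heckeSetoid ℓ) ≃ Quotient ((X.toShimuraCurveData fd₀ h₀).heckeSetoid ℓ)) := by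
  classical
  have hO₀ : Brandt.IsOrder X.B X.O₀ := X.isEichlerOrder.isOrder
  set X₀ : ShimuraCurveData D M := X.toShimuraCurveData fd₀ h₀ with hX₀
  have hsq : ∀ q ∈ C, ¬ (q : ℤ) ^ 2 ∣ (ℓ : ℤ) := by
    intro q hq hdvd
    have hq : q.Prime := (X.coprime q hq).1
    have h1 : (q : ℤ) ∣ (ℓ : ℤ) := (dvd_pow_self (q : ℤ) two_ne_zero).trans hdvd
    have h2 : q ∣ ℓ := by exact_mod_cast h1
    exact hℓC q ‹q ∈ C› ((Nat.prime_dvd_prime_iff_eq hq hℓ).mp h2)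
  -- the inclusion of Hecke sets and the induced map on cosets
  have hincl : ∀ s : X.heckeSet ℓ, (s : GL (Fin 2) ℝ) ∈ X₀.heckeSet ℓ := fun s => by
    obtain ⟨⟨x, hx, hxs⟩, hdet⟩ := s.2
    exact ⟨⟨x, X.le hx, hxs⟩, hdet⟩
  set ι₀ : X.heckeSet ℓ → X₀.heckeSet ℓ := fun s => ⟨s, hincl s⟩ with hι₀
  have hresp : ∀ s s' : X.heckeSet ℓ, (X.heckeSetoid ℓ).r s s' → (X₀.heckeSetoid ℓ).r (ι₀ s) (ι₀ s') := by
    rintro s s' ⟨γ, hγ, hγeq⟩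
    exact ⟨γ, X.gamma_le_normOneUnits_hull hγ, hγeq⟩
  set F : Quotient (X.heckeSetoid ℓ) → Quotient (X₀.heckeSetoid ℓ) := Quotient.map' ι₀ hresp with hF
  have hF_mk : ∀ s, F (Quotient.mk _ s) = Quotient.mk _ (ι₀ s) := fun s => rfl
  refine ⟨Equiv.ofBijective F ⟨?_, ?_⟩⟩
  · -- injective
    intro a a' haa'
    induction a using Quotient.inductionOn with
    | h s =>
      induction a' using Quotient.inductionOn with
      | h s' =>
        rw [hF_mk, hF_mk] at haa'
        obtain ⟨γ₀, hγ₀, hγeq⟩ := Quotient.exact haa'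
        exact Quotient.sound ⟨γ₀, X.mem_Gamma_of_mul_mem_heckeSet hsq hγ₀ s.2 s'.2 hγeq, hγeq⟩
  · -- surjective
    intro a
    induction a using Quotient.inductionOn with
    | h s₀ =>
      obtain ⟨⟨x₀, hx₀, hxs₀⟩, hdet₀⟩ := s₀.2
      change X.B at x₀
      change x₀ ∈ X.O₀ at hx₀
      change X.ι x₀ = ((s₀ : GL (Fin 2) ℝ) : Matrix (Fin 2) (Fin 2) ℝ) at hxs₀
      have hn₀ : reducedNorm ℚ X.B x₀ = ℓ := by
        have h1 : ((reducedNorm ℚ X.B x₀ : ℚ) : ℝ) = (ℓ : ℝ) := by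
          rw [← eq_ratCast (algebraMap ℚ ℝ), ← AlgHom.det_eq_reducedNorm X.ι, hxs₀, hdet₀]
        exact_mod_cast h1
      obtain ⟨u, huO, hnu, hux⟩ := X.exists_normOne_mul_mem hℓ hℓC hx₀ hn₀
      -- the hull unit `γ₀ = ι(u)`
      set ub : X.B := standardInvolution ℚ X.B u with hub
      have hubO : ub ∈ X.O₀ := hO₀.standardInvolution_mem huO
      have hubu : ub * u = 1 := by
        rw [hub, IsQuaternionAlgebra.standardInvolution_mul (K := ℚ), hnu, map_one]
      have hdet1 : (X.ι u).det = 1 := by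
        rw [AlgHom.det_eq_reducedNorm X.ι, hnu, map_one]
      set γ₀ : GL (Fin 2) ℝ := Matrix.GeneralLinearGroup.mkOfDetNeZero (X.ι u)
        (by rw [hdet1]; exact one_ne_zero) with hγ₀
      have hγval : (γ₀ : Matrix (Fin 2) (Fin 2) ℝ) = X.ι u := rfl
      have hγinv : ((γ₀⁻¹ : GL (Fin 2) ℝ) : Matrix (Fin 2) (Fin 2) ℝ) = X.ι ub := by
        rw [Matrix.coe_units_inv, hγval]
        exact Matrix.inv_eq_left_inv (by rw [← map_mul, hubu, map_one])
      have hγ₀Γ : γ₀ ∈ X₀.Gamma := by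
        refine ⟨⟨u, huO, hγval.symm⟩, ⟨ub, hubO, hγinv.symm⟩, ?_⟩
        ext
        rw [Matrix.GeneralLinearGroup.val_det_apply, hγval, hdet1, Units.val_one]
      -- `γ₀ s₀ ∈ ι(O(ℓ))`
      have hs : γ₀ * (s₀ : GL (Fin 2) ℝ) ∈ X.heckeSet ℓ := by
        refine ⟨⟨u * x₀, hux, ?_⟩, ?_⟩
        · rw [map_mul, Units.val_mul, hγval, hxs₀]
        · rw [Units.val_mul, Matrix.det_mul, hγval, hdet1, one_mul, hdet₀]
      refine ⟨Quotient.mk _ ⟨γ₀ * (s₀ : GL (Fin 2) ℝ), hs⟩, ?_⟩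
      rw [hF_mk]
      refine Quotient.sound ⟨γ₀⁻¹, inv_mem hγ₀Γ, ?_⟩
      change γ₀⁻¹ * (γ₀ * (s₀ : GL (Fin 2) ℝ)) = s₀
      rw [inv_mul_cancel_left]

/-- **`#(Γ ∖ ι(O(ℓ))) = #(Γ₀ ∖ ι(O₀(ℓ)))`** for a prime `ℓ` outside `C`, and one coset space is finite iff
the other is. [cite: ShimuraIATAF1971, Prop. 3.36 and §3.3] -/
theorem natCard_quotient_heckeSetoid_eq_hull (fd₀ : Set UpperHalfPlane)
    (h₀ : IsHypFundamentalDomain (normOneUnits X.ι X.isEichlerOrder.isOrder) fd₀)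
    {ℓ : ℕ} (hℓ : ℓ.Prime) (hℓC : ∀ q ∈ C, q ≠ ℓ) :
    Nat.card (Quotient (X.heckeSetoid ℓ)) =
        Nat.card (Quotient ((X.toShimuraCurveData fd₀ h₀).heckeSetoid ℓ)) ∧
      (Finite (Quotient (X.heckeSetoid ℓ)) ↔
        Finite (Quotient ((X.toShimuraCurveData fd₀ h₀).heckeSetoid ℓ))) := by
  obtain ⟨e⟩ := X.nonempty_quotient_heckeSetoid_equiv_hull fd₀ h₀ hℓ hℓC
  exact ⟨Nat.card_congr e, ⟨fun _ => Finite.of_equiv _ e, fun _ => Finite.of_equiv _ e.symm⟩⟩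

end CartanLevelCurveData

end Literature.NumberTheory.Automorphic

end
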